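import Mathlib
import Summits.Ventures.PercRepro2.MixChordBern
import Summits.Ventures.PercRepro2.HMFRootEdgeChordTheorem
import Summits.Ventures.PercRepro2.OneEdge

/-!
# Reading the open child of the literal `o`-edge on the closed child
(blind cell PercRepro2, night-1 g28; proofs/NIGHT1-G28.md §6 (a))

Along `f = {o, a₁}`: opening `f` kills the configurations with `o ∈ C₂` (`Q` fails), leaves those with
`o ∈ C₁` unchanged and merges the cluster of `o` into `C₁` otherwise.  So on the configurations of
`Qo := Q ∩ {a₂ ↮ o}` a `p[f ↦ 1]`-event READS AS a `p[f ↦ 0]`-event (`ReadsAs`): `v ∈ C₁` as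
`v ∈ C₁ ∨ v ↔ o` (`reads_conn1`, `readL`), `v ∈ C₂` as itself (`reads_conn2`), closed under `∩`, `∪`, `ᶜ`
(`ReadsAs.inter`, `ReadsAs.union`, `ReadsAs.compl`), and **`prob_read`**: `P¹(Q ∩ S) = P⁰(Qo ∩ S′)` whenever
`S` reads as `S′` (g18's coupling `RootEdge.prob_update_one_eq_prob_update_zero_of_iff` after
`RootEdge.Q_update_true_iff`).  The twelve atoms of `MixChordBern.lean`'s `A`, `B` at `p[f ↦ 1]` are then
`p[f ↦ 0]`-probabilities of explicit events — `Z_read`, `D_read`, `Do_read`, `EQbo_read`, `EQb3_read`,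
`EQb3o_read`, `EQo_read`, `EQ3_read`, `EQ3o_read`, `PDb_read`, `PDbo_read`, `gap_read` (the gap is not
`Q`-restricted: `prob_conn1_read`, `prob_conn2_read` read the two connection events directly) — so `A`, `B` of
any instance along `{o, a₁}` are explicit polynomials in `p[f ↦ 0]`-probabilities, and the thirty-four refined
cells of NIGHT1-G28.md §2 are their natural coordinates.

Own code; standard axioms.
-/

namespace Summit.Ventures.PercRepro2

open UnionCluster CovForm

namespace Mix

namespace OEdgeRead

section Reads

variable {V : Type*} {E : Type*} [DecidableEq E]

variable (ends : E → Sym2 V) (o a₁ a₂ : V) (f : E)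

/-- `Q` of the open child read on the closed child: `Q ∩ {a₂ ↮ o}`. -/
def Qo : Set (Config E) := avoidAll ends a₂ {a₁} ∩ (connEvent ends a₂ o)ᶜ

/-- `v ∈ C₁` after opening `f = {o, a₁}` reads as `v ∈ C₁ ∨ v ↔ o` before. -/
def readL (v : V) : Set (Config E) := connEvent ends a₁ v ∪ connEvent ends o v

/-- A `p[f ↦ 1]`-event `S` READS AS the `p[f ↦ 0]`-event `S′` on the configurations of `Qo`. -/
def ReadsAs (S S' : Set (Config E)) : Prop :=
  ∀ ω : Config E, Function.update ω f false ∈ Qo ends o a₁ a₂ →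
    (Function.update ω f true ∈ S ↔ Function.update ω f false ∈ S')

variable {ends o a₁ a₂ f}

/-- `ω[f ↦ 1] = (ω[f ↦ 0])[f ↦ 1]`. -/
lemma update_true_eq (ω : Config E) :
    Function.update ω f true = Function.update (Function.update ω f false) f true := by
  rw [Function.update_idem]

omit [DecidableEq E] in
/-- The two conjuncts of `Qo` as connections. -/
lemma mem_Qo_iff (ω : Config E) :
    ω ∈ Qo ends o a₁ a₂ ↔ ¬ Conn ends ω a₂ a₁ ∧ ¬ Conn ends ω a₂ o := by
  simp only [Qo, Set.mem_inter_iff, Set.mem_compl_iff, mem_avoidAll, Finset.mem_singleton, forall_eq,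
    mem_connEvent]

/-- **`v ∈ C₁` reads as `v ∈ C₁ ∨ v ↔ o`.** -/
lemma reads_conn1 (hf : ends f = s(o, a₁)) (v : V) :
    ReadsAs ends o a₁ a₂ f (connEvent ends a₁ v) (readL ends o a₁ v) := by
  intro ω _
  rw [update_true_eq ω]
  simp only [readL, Set.mem_union, mem_connEvent, OneEdge.conn_update_true_iff hf]
  constructor
  · rintro (h | ⟨_, h⟩ | ⟨_, h⟩)
    · exact Or.inl h
    · exact Or.inl h
    · exact Or.inr h
  · rintro (h | h)
    · exact Or.inl h
    · exact Or.inr (Or.inr ⟨conn_refl _ _ _, h⟩)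

/-- **`v ∈ C₂` reads as itself** (on `Qo`). -/
lemma reads_conn2 (hf : ends f = s(o, a₁)) (v : V) :
    ReadsAs ends o a₁ a₂ f (connEvent ends a₂ v) (connEvent ends a₂ v) := by
  intro ω hQ
  rw [mem_Qo_iff] at hQ
  rw [update_true_eq ω]
  simp only [mem_connEvent, OneEdge.conn_update_true_iff hf]
  constructor
  · rintro (h | ⟨h, _⟩ | ⟨h, _⟩)
    · exact h
    · exact absurd h hQ.2
    · exact absurd h hQ.1
  · exact fun h => Or.inl h

/-- Readings are closed under intersection. -/
lemma ReadsAs.inter {S₁ S₁' S₂ S₂' : Set (Config E)} (h₁ : ReadsAs ends o a₁ a₂ f S₁ S₁')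
    (h₂ : ReadsAs ends o a₁ a₂ f S₂ S₂') : ReadsAs ends o a₁ a₂ f (S₁ ∩ S₂) (S₁' ∩ S₂') := by
  intro ω hQ
  rw [Set.mem_inter_iff, Set.mem_inter_iff, h₁ ω hQ, h₂ ω hQ]

/-- Readings are closed under union. -/
lemma ReadsAs.union {S₁ S₁' S₂ S₂' : Set (Config E)} (h₁ : ReadsAs ends o a₁ a₂ f S₁ S₁')
    (h₂ : ReadsAs ends o a₁ a₂ f S₂ S₂') : ReadsAs ends o a₁ a₂ f (S₁ ∪ S₂) (S₁' ∪ S₂') := by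
  intro ω hQ
  rw [Set.mem_union, Set.mem_union, h₁ ω hQ, h₂ ω hQ]

/-- Readings are closed under complement. -/
lemma ReadsAs.compl {S S' : Set (Config E)} (h : ReadsAs ends o a₁ a₂ f S S') :
    ReadsAs ends o a₁ a₂ f Sᶜ S'ᶜ := by
  intro ω hQ
  rw [Set.mem_compl_iff, Set.mem_compl_iff, h ω hQ]

/-- `univ` reads as `univ`. -/
lemma ReadsAs.univ : ReadsAs ends o a₁ a₂ f Set.univ Set.univ := fun _ _ => Iff.rfl

end Reads

section Prob

variable {V : Type*} {E : Type*} [Fintype E] [DecidableEq E] {R : Type*} [Field R]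

variable (p : E → R) {ends : E → Sym2 V} {o a₁ a₂ : V} {f : E}

/-- **The coupling of the two children on a reading**: `P¹(Q ∩ S) = P⁰(Qo ∩ S′)`. -/
theorem prob_read (hf : ends f = s(o, a₁)) {S S' : Set (Config E)} (h : ReadsAs ends o a₁ a₂ f S S') :
    prob (Function.update p f 1) (avoidAll ends a₂ {a₁} ∩ S) =
      prob (Function.update p f 0) (Qo ends o a₁ a₂ ∩ S') := by
  apply RootEdge.prob_update_one_eq_prob_update_zero_of_iff p
  intro ω
  rw [Set.mem_inter_iff, Set.mem_inter_iff, RootEdge.Q_update_true_iff ends hf ω]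
  exact ⟨fun ⟨h1, h2⟩ => ⟨h1, (h ω h1).1 h2⟩, fun ⟨h1, h2⟩ => ⟨h1, (h ω h1).2 h2⟩⟩

/-- `Z¹ = P⁰(Qo)`. -/
theorem Z_read (hf : ends f = s(o, a₁)) :
    prob (Function.update p f 1) (avoidAll ends a₂ {a₁}) = prob (Function.update p f 0) (Qo ends o a₁ a₂) := by
  have h := prob_read p hf (ReadsAs.univ (ends := ends) (o := o) (a₁ := a₁) (a₂ := a₂) (f := f))
  rwa [Set.inter_univ, Set.inter_univ] at h

end Prob

section Atoms

variable {V : Type*} {E : Type*} [Fintype E] [DecidableEq E] {R : Type*} [Field R]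

variable (ends : E → Sym2 V) (a₁ a₂ a₃ : V)

omit [Fintype E] [DecidableEq E] in
/-- `PD = Q ∩ {a₃ ∉ C₁ ∪ C₂}` with the connections oriented from the roots. -/
lemma PDEvent_eq_Q_inter :
    PDEvent ends a₁ a₂ a₃ = avoidAll ends a₂ {a₁} ∩ (connEvent ends a₁ a₃ ∪ connEvent ends a₂ a₃)ᶜ := by
  ext ω
  simp only [PDEvent, Dtilde, UnionCluster.inU, Set.mem_inter_iff, Set.mem_compl_iff, Set.mem_union,
    mem_connEvent, mem_avoidAll, Finset.mem_singleton, forall_eq]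
  constructor
  · rintro ⟨h1, h2⟩
    refine ⟨fun h => h1 (conn_symm h), fun h => h2 ?_⟩
    rcases h with h | h
    · exact Or.inl (conn_symm h)
    · exact Or.inr (conn_symm h)
  · rintro ⟨h1, h2⟩
    refine ⟨fun h => h1 (conn_symm h), fun h => h2 ?_⟩
    rcases h with h | h
    · exact Or.inl (conn_symm h)
    · exact Or.inr (conn_symm h)

omit [Fintype E] [DecidableEq E] in
/-- `T = Q ∩ {a₃ ∈ C₂}`. -/
lemma TEvent_eq_Q_inter : TEvent ends a₁ a₂ a₃ = avoidAll ends a₂ {a₁} ∩ connEvent ends a₂ a₃ := by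
  ext ω
  simp only [TEvent, Set.mem_inter_iff, Set.mem_compl_iff, mem_connEvent, mem_avoidAll, Finset.mem_singleton,
    forall_eq]

omit [Fintype E] [DecidableEq E] in
/-- `T′ = Q ∩ {a₃ ∈ C₁}`. -/
lemma TEvent_swap_eq_Q_inter : TEvent ends a₂ a₁ a₃ = avoidAll ends a₂ {a₁} ∩ connEvent ends a₁ a₃ := by
  ext ω
  simp only [TEvent, Set.mem_inter_iff, Set.mem_compl_iff, mem_connEvent, mem_avoidAll, Finset.mem_singleton,
    forall_eq]
  exact ⟨fun ⟨h1, h2⟩ => ⟨fun h => h1 (conn_symm h), h2⟩, fun ⟨h1, h2⟩ => ⟨fun h => h1 (conn_symm h), h2⟩⟩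

/-- `v ∉ U` after opening `f`, read on the closed child. -/
def nU (ends : E → Sym2 V) (o a₁ a₂ v : V) : Set (Config E) := (readL ends o a₁ v ∪ connEvent ends a₂ v)ᶜ

variable (p : E → R) {ends} (o : V) {f : E}

/-- **`D¹ = P⁰(Qo ∩ {a₃ ∉ U after})`.** -/
theorem D_read (hf : ends f = s(o, a₁)) :
    prob (Function.update p f 1) (PDEvent ends a₁ a₂ a₃) =
      prob (Function.update p f 0) (Qo ends o a₁ a₂ ∩ nU ends o a₁ a₂ a₃) := by
  rw [PDEvent_eq_Q_inter]
  exact prob_read p hf (((reads_conn1 hf a₃).union (reads_conn2 hf a₃)).compl)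

/-- **`D_o¹`** read on the closed child. -/
theorem Do_read (hf : ends f = s(o, a₁)) :
    Do (Function.update p f 1) ends o a₁ a₂ a₃ =
      prob (Function.update p f 0) (Qo ends o a₁ a₂ ∩ (nU ends o a₁ a₂ a₃ ∩ readL ends o a₁ o)) +
        prob (Function.update p f 0) (Qo ends o a₁ a₂ ∩ (nU ends o a₁ a₂ a₃ ∩ connEvent ends a₂ o)) := by
  unfold Do
  rw [PDEvent_eq_Q_inter, Set.inter_assoc, Set.inter_assoc]
  rw [prob_read p hf ((((reads_conn1 hf a₃).union (reads_conn2 hf a₃)).compl).inter (reads_conn1 hf o)),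
    prob_read p hf ((((reads_conn1 hf a₃).union (reads_conn2 hf a₃)).compl).inter (reads_conn2 hf o))]
  rfl

/-- **`E_Q[σ_bσ_o]` at the open child** read on the closed child. -/
theorem EQbo_read (hf : ends f = s(o, a₁)) (b : V) :
    EQbo (Function.update p f 1) ends o a₁ a₂ b =
      prob (Function.update p f 0) (Qo ends o a₁ a₂ ∩ (readL ends o a₁ o ∩ readL ends o a₁ b)) +
        prob (Function.update p f 0) (Qo ends o a₁ a₂ ∩ (connEvent ends a₂ o ∩ connEvent ends a₂ b)) -
        prob (Function.update p f 0) (Qo ends o a₁ a₂ ∩ (connEvent ends a₂ o ∩ readL ends o a₁ b)) -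
        prob (Function.update p f 0) (Qo ends o a₁ a₂ ∩ (readL ends o a₁ o ∩ connEvent ends a₂ b)) := by
  unfold EQbo
  rw [prob_read p hf ((reads_conn1 hf o).inter (reads_conn1 hf b)),
    prob_read p hf ((reads_conn2 hf o).inter (reads_conn2 hf b)),
    prob_read p hf ((reads_conn2 hf o).inter (reads_conn1 hf b)),
    prob_read p hf ((reads_conn1 hf o).inter (reads_conn2 hf b))]

/-- **`E_Q[σ_bσ₃]` at the open child** read on the closed child. -/
theorem EQb3_read (hf : ends f = s(o, a₁)) (b : V) :
    EQb3 (Function.update p f 1) ends a₁ a₂ a₃ b =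
      prob (Function.update p f 0) (Qo ends o a₁ a₂ ∩ (readL ends o a₁ a₃ ∩ readL ends o a₁ b)) +
        prob (Function.update p f 0) (Qo ends o a₁ a₂ ∩ (connEvent ends a₂ a₃ ∩ connEvent ends a₂ b)) -
        prob (Function.update p f 0) (Qo ends o a₁ a₂ ∩ (connEvent ends a₂ a₃ ∩ readL ends o a₁ b)) -
        prob (Function.update p f 0) (Qo ends o a₁ a₂ ∩ (readL ends o a₁ a₃ ∩ connEvent ends a₂ b)) := by
  unfold EQb3
  rw [TEvent_swap_eq_Q_inter ends a₁ a₂ a₃, TEvent_eq_Q_inter ends a₁ a₂ a₃, Set.inter_assoc, Set.inter_assoc,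
    Set.inter_assoc, Set.inter_assoc]
  rw [prob_read p hf ((reads_conn1 hf a₃).inter (reads_conn1 hf b)),
    prob_read p hf ((reads_conn2 hf a₃).inter (reads_conn2 hf b)),
    prob_read p hf ((reads_conn2 hf a₃).inter (reads_conn1 hf b)),
    prob_read p hf ((reads_conn1 hf a₃).inter (reads_conn2 hf b))]

/-- **`E_Q[σ₃]` at the open child** read on the closed child. -/
theorem EQ3_read (hf : ends f = s(o, a₁)) :
    EQ3 (Function.update p f 1) ends a₁ a₂ a₃ =
      prob (Function.update p f 0) (Qo ends o a₁ a₂ ∩ readL ends o a₁ a₃) -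
        prob (Function.update p f 0) (Qo ends o a₁ a₂ ∩ connEvent ends a₂ a₃) := by
  unfold EQ3
  rw [TEvent_swap_eq_Q_inter ends a₁ a₂ a₃, TEvent_eq_Q_inter ends a₁ a₂ a₃, prob_read p hf (reads_conn1 hf a₃),
    prob_read p hf (reads_conn2 hf a₃)]

/-- **`E_Q[σ_o]` at the open child** read on the closed child. -/
theorem EQo_read (hf : ends f = s(o, a₁)) :
    EQo (Function.update p f 1) ends o a₁ a₂ =
      prob (Function.update p f 0) (Qo ends o a₁ a₂ ∩ readL ends o a₁ o) -
        prob (Function.update p f 0) (Qo ends o a₁ a₂ ∩ connEvent ends a₂ o) := by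
  unfold EQo
  rw [prob_read p hf (reads_conn1 hf o), prob_read p hf (reads_conn2 hf o)]

/-- **`E_Q[σ₃ 1_{o ∈ U}]` at the open child** read on the closed child. -/
theorem EQ3o_read (hf : ends f = s(o, a₁)) :
    EQ3o (Function.update p f 1) ends o a₁ a₂ a₃ =
      prob (Function.update p f 0) (Qo ends o a₁ a₂ ∩ (readL ends o a₁ a₃ ∩ readL ends o a₁ o)) +
        prob (Function.update p f 0) (Qo ends o a₁ a₂ ∩ (readL ends o a₁ a₃ ∩ connEvent ends a₂ o)) -
        prob (Function.update p f 0) (Qo ends o a₁ a₂ ∩ (connEvent ends a₂ a₃ ∩ readL ends o a₁ o)) -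
        prob (Function.update p f 0) (Qo ends o a₁ a₂ ∩ (connEvent ends a₂ a₃ ∩ connEvent ends a₂ o)) := by
  unfold EQ3o
  rw [TEvent_swap_eq_Q_inter ends a₁ a₂ a₃, TEvent_eq_Q_inter ends a₁ a₂ a₃, Set.inter_assoc, Set.inter_assoc,
    Set.inter_assoc, Set.inter_assoc]
  rw [prob_read p hf ((reads_conn1 hf a₃).inter (reads_conn1 hf o)),
    prob_read p hf ((reads_conn1 hf a₃).inter (reads_conn2 hf o)),
    prob_read p hf ((reads_conn2 hf a₃).inter (reads_conn1 hf o)),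
    prob_read p hf ((reads_conn2 hf a₃).inter (reads_conn2 hf o))]

/-- **`P(PD, b ∈ U)` at the open child** read on the closed child. -/
theorem PDb_read (hf : ends f = s(o, a₁)) (b : V) :
    PDb (Function.update p f 1) ends a₁ a₂ a₃ b =
      prob (Function.update p f 0) (Qo ends o a₁ a₂ ∩ (nU ends o a₁ a₂ a₃ ∩ readL ends o a₁ b)) +
        prob (Function.update p f 0) (Qo ends o a₁ a₂ ∩ (nU ends o a₁ a₂ a₃ ∩ connEvent ends a₂ b)) := by
  unfold PDb
  rw [PDEvent_eq_Q_inter, Set.inter_assoc, Set.inter_assoc]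
  rw [prob_read p hf ((((reads_conn1 hf a₃).union (reads_conn2 hf a₃)).compl).inter (reads_conn1 hf b)),
    prob_read p hf ((((reads_conn1 hf a₃).union (reads_conn2 hf a₃)).compl).inter (reads_conn2 hf b))]
  rfl

/-- **`E_Q[σ_bσ₃ 1_{o ∈ U}]` at the open child** read on the closed child. -/
theorem EQb3o_read (hf : ends f = s(o, a₁)) (b : V) :
    EQb3o (Function.update p f 1) ends o a₁ a₂ a₃ b =
      prob (Function.update p f 0) (Qo ends o a₁ a₂ ∩ (readL ends o a₁ a₃ ∩ (readL ends o a₁ o ∩ readL ends o a₁ b))) +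
        prob (Function.update p f 0) (Qo ends o a₁ a₂ ∩ (readL ends o a₁ a₃ ∩ (connEvent ends a₂ o ∩ readL ends o a₁ b))) +
        prob (Function.update p f 0) (Qo ends o a₁ a₂ ∩ (connEvent ends a₂ a₃ ∩ (readL ends o a₁ o ∩ connEvent ends a₂ b))) +
        prob (Function.update p f 0) (Qo ends o a₁ a₂ ∩ (connEvent ends a₂ a₃ ∩ (connEvent ends a₂ o ∩ connEvent ends a₂ b))) -
        prob (Function.update p f 0) (Qo ends o a₁ a₂ ∩ (connEvent ends a₂ a₃ ∩ (readL ends o a₁ o ∩ readL ends o a₁ b))) -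
        prob (Function.update p f 0) (Qo ends o a₁ a₂ ∩ (connEvent ends a₂ a₃ ∩ (connEvent ends a₂ o ∩ readL ends o a₁ b))) -
        prob (Function.update p f 0) (Qo ends o a₁ a₂ ∩ (readL ends o a₁ a₃ ∩ (readL ends o a₁ o ∩ connEvent ends a₂ b))) -
        prob (Function.update p f 0) (Qo ends o a₁ a₂ ∩ (readL ends o a₁ a₃ ∩ (connEvent ends a₂ o ∩ connEvent ends a₂ b))) := by
  unfold EQb3o
  rw [TEvent_swap_eq_Q_inter ends a₁ a₂ a₃, TEvent_eq_Q_inter ends a₁ a₂ a₃, Set.inter_assoc, Set.inter_assoc,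
    Set.inter_assoc, Set.inter_assoc, Set.inter_assoc, Set.inter_assoc, Set.inter_assoc, Set.inter_assoc]
  rw [prob_read p hf ((reads_conn1 hf a₃).inter ((reads_conn1 hf o).inter (reads_conn1 hf b))),
    prob_read p hf ((reads_conn1 hf a₃).inter ((reads_conn2 hf o).inter (reads_conn1 hf b))),
    prob_read p hf ((reads_conn2 hf a₃).inter ((reads_conn1 hf o).inter (reads_conn2 hf b))),
    prob_read p hf ((reads_conn2 hf a₃).inter ((reads_conn2 hf o).inter (reads_conn2 hf b))),
    prob_read p hf ((reads_conn2 hf a₃).inter ((reads_conn1 hf o).inter (reads_conn1 hf b))),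
    prob_read p hf ((reads_conn2 hf a₃).inter ((reads_conn2 hf o).inter (reads_conn1 hf b))),
    prob_read p hf ((reads_conn1 hf a₃).inter ((reads_conn1 hf o).inter (reads_conn2 hf b))),
    prob_read p hf ((reads_conn1 hf a₃).inter ((reads_conn2 hf o).inter (reads_conn2 hf b)))]

/-- **`P(PD, b ∈ U, o ∈ U)` at the open child** read on the closed child. -/
theorem PDbo_read (hf : ends f = s(o, a₁)) (b : V) :
    PDbo (Function.update p f 1) ends o a₁ a₂ a₃ b =
      prob (Function.update p f 0) (Qo ends o a₁ a₂ ∩ (nU ends o a₁ a₂ a₃ ∩ (readL ends o a₁ o ∩ readL ends o a₁ b))) +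
        prob (Function.update p f 0) (Qo ends o a₁ a₂ ∩ (nU ends o a₁ a₂ a₃ ∩ (connEvent ends a₂ o ∩ readL ends o a₁ b))) +
        prob (Function.update p f 0) (Qo ends o a₁ a₂ ∩ (nU ends o a₁ a₂ a₃ ∩ (readL ends o a₁ o ∩ connEvent ends a₂ b))) +
        prob (Function.update p f 0) (Qo ends o a₁ a₂ ∩ (nU ends o a₁ a₂ a₃ ∩ (connEvent ends a₂ o ∩ connEvent ends a₂ b))) := by
  unfold PDbo
  rw [PDEvent_eq_Q_inter, Set.inter_assoc, Set.inter_assoc, Set.inter_assoc, Set.inter_assoc]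
  rw [prob_read p hf ((((reads_conn1 hf a₃).union (reads_conn2 hf a₃)).compl).inter
      ((reads_conn1 hf o).inter (reads_conn1 hf b))),
    prob_read p hf ((((reads_conn1 hf a₃).union (reads_conn2 hf a₃)).compl).inter
      ((reads_conn2 hf o).inter (reads_conn1 hf b))),
    prob_read p hf ((((reads_conn1 hf a₃).union (reads_conn2 hf a₃)).compl).inter
      ((reads_conn1 hf o).inter (reads_conn2 hf b))),
    prob_read p hf ((((reads_conn1 hf a₃).union (reads_conn2 hf a₃)).compl).inter
      ((reads_conn2 hf o).inter (reads_conn2 hf b)))]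
  rfl

/-- `a₁ ↔ b` after opening `f = {o, a₁}` reads as `a₁ ↔ b ∨ o ↔ b` (no `Q` needed). -/
theorem prob_conn1_read (hf : ends f = s(o, a₁)) (b : V) :
    prob (Function.update p f 1) (connEvent ends a₁ b) = prob (Function.update p f 0) (readL ends o a₁ b) := by
  apply RootEdge.prob_update_one_eq_prob_update_zero_of_iff p
  intro ω
  rw [update_true_eq ω]
  simp only [readL, Set.mem_union, mem_connEvent, OneEdge.conn_update_true_iff hf]
  constructor
  · rintro (h | ⟨_, h⟩ | ⟨_, h⟩)
    · exact Or.inl h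
    · exact Or.inl h
    · exact Or.inr h
  · rintro (h | h)
    · exact Or.inl h
    · exact Or.inr (Or.inr ⟨conn_refl _ _ _, h⟩)

/-- `a₂ ↔ b` after opening `f = {o, a₁}` reads as `a₂ ↔ b ∨ (a₂ ↔ o ∧ a₁ ↔ b) ∨ (a₂ ↔ a₁ ∧ o ↔ b)`. -/
theorem prob_conn2_read (hf : ends f = s(o, a₁)) (b : V) :
    prob (Function.update p f 1) (connEvent ends a₂ b) =
      prob (Function.update p f 0) (connEvent ends a₂ b ∪ (connEvent ends a₂ o ∩ connEvent ends a₁ b) ∪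
        (connEvent ends a₂ a₁ ∩ connEvent ends o b)) := by
  apply RootEdge.prob_update_one_eq_prob_update_zero_of_iff p
  intro ω
  rw [update_true_eq ω]
  simp only [Set.mem_union, Set.mem_inter_iff, mem_connEvent, OneEdge.conn_update_true_iff hf]
  tauto

/-- **The labelling gap at the open child** read on the closed child. -/
theorem gap_read (hf : ends f = s(o, a₁)) (b : V) :
    gap (Function.update p f 1) ends a₁ a₂ b =
      prob (Function.update p f 0) (connEvent ends a₂ b ∪ (connEvent ends a₂ o ∩ connEvent ends a₁ b) ∪
        (connEvent ends a₂ a₁ ∩ connEvent ends o b)) -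
        prob (Function.update p f 0) (readL ends o a₁ b) := by
  unfold gap
  rw [prob_conn1_read (p := p) (hf := hf) (b := b), prob_conn2_read (p := p) (hf := hf) (b := b)]

end Atoms

end OEdgeRead

end Mix

end Summit.Ventures.PercRepro2
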